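import Summits.QuantumFields.YangMills.Theorems.BalabanUVNodesN19SingleModeMomentLogFree
import Summits.QuantumFields.YangMills.Theorems.BalabanUVNodesN19KinkLowerBoundMomentCurrency

/-!
# YM-DAG node N19 (= NE7 proper) — THE ROW «UNIFORM MOMENTS → SINGLE MODE» IS `Θ(ωd∕L)`: both sides in one declaration (`L = t·log 2`)

Cell `pub-ymgap`, HUMAN RULING D-0062 (Track A) ∕ D-0149 (work-bound push), R141 (C) wider-strategy seat `pub-ymgap-dag-n19-e` (strategy
s3 = ALTERNATIVE CURRENCY), generation g32, module 9 (lineage module 147).  Route `Summits/QuantumFields/YangMills/Theses/BalabanUVNodes.lean`,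
cluster item K3⁸ «SpineGivenEndpointR13SepCoPHV» (stmt-QuantumFields-27366); filed `--supports` that item `--as helper` (it proves no registered
stub).  COUNT-NEUTRAL: [bookkeeping] over the lineage BY NAME — module 146 `…N19SingleModeMomentLogFree` (`abs_integral_sin_l1Norm_sub_le_logFree`,
the LOG-FREE upper side) and module 138 `…N19KinkLowerBoundMomentCurrency` (`exists_laws_closeMixedMoments_sin_l1Norm`, the explicit pair with
`2^{−t}`-close mixed moments); TOY laws, no scheme object, no Theses import; NOT a discharge claim.

CONTENT.  ★★★ `laws_momentCurrency_sinMode_twoSided`: for `t ≥ 1478` (so `L := t·log 2 ≥ 1024`), `ω ≥ 0`, finite `ι` (`d = |ι|`) with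
`ωd·(log₂t)² ≤ t∕32768`: (UPPER) every two probability laws on `ℝ^ι` carried by `[−1,1]^ι` whose mixed moments are `2^{−t}`-close satisfy
`|∫sin(ωΣ|x_i|)dP − ∫sin(ωΣ|x_i|)dQ| ≤ 340·ωd∕(t log 2) + e^{−t log 2∕2}`; (LOWER) there IS such a pair (moments of total degree `≤ t` even EQUAL) with
`∫sin(ωΣ|x_i|)dQ − ∫sin(ωΣ|x_i|)dP ≥ ωd∕(20πt)`.  READING (CURRENCY-MAP v10's row «UNIFORM MOMENTS `r` → single mode», `L = log r⁻¹`): was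
`ωd·log2∕(20πL) ≤ · ≲ C·ωd·log²L∕L` (two-sided up to `log²L`); now **`Θ(ωd∕L)` up to the absolute constant `340·20π∕log 2` and the additive `e^{−L∕2}`**,
for `ωd ≲ L∕log²L`.  The currency of N19's uniform `Target` — still no consumer in the DAG; nothing of Bałaban's; constants nowhere optimised.

HONEST FRAMING (binding).  Elementary and [folklore]∕[bookkeeping]; TOY laws; NO consumer in the DAG today (the seat's own currency map); nothing of
Bałaban's instantiated; NE7 NOT PRINTED, NOT proved; N19 NOT discharged; count-neutral.  One finite `T⁴` programme at fixed `ε`; nothing continuum ∕ `ℝ⁴` ∕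
OS ∕ mass-gap ∕ Clay.  0 `def` ∕ 0 `sorry`.
-/

noncomputable section

open Finset MeasureTheory
open scoped Real

namespace Summit.QuantumFields.YangMills.Theorems.BalabanUVNodesN19SingleModeMomentTwoSided

open Summit.QuantumFields.YangMills.Theorems.BalabanUVNodesN19SingleModeMomentLogFree (abs_integral_sin_l1Norm_sub_le_logFree)
open Summit.QuantumFields.YangMills.Theorems.BalabanUVNodesN19KinkLowerBoundMomentCurrency (exists_laws_closeMixedMoments_sin_l1Norm)

variable {ι : Type*} [Fintype ι]

/-- The budget `L = t·log 2`: for `t ≥ 1478`, `L ≥ 1024`, `(½)^t = e^{−L}`, and `log₂L ≤ log₂t`. [bookkeeping] -/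
theorem budget_of_halfPow {t : ℕ} (ht : 1478 ≤ t) :
    1024 ≤ (t : ℝ) * Real.log 2 ∧ ((1 / 2 : ℝ) ^ t = Real.exp (-((t : ℝ) * Real.log 2))) ∧
      Real.logb 2 ((t : ℝ) * Real.log 2) ^ 2 ≤ Real.logb 2 t ^ 2 := by
  have htr : (1478 : ℝ) ≤ t := by exact_mod_cast ht
  have hlo : 0.6931471803 < Real.log 2 := Real.log_two_gt_d9
  have hhi : Real.log 2 < 0.6931471808 := Real.log_two_lt_d9
  have ht0 : (0 : ℝ) < t := by linarith
  have hL0 : 0 < (t : ℝ) * Real.log 2 := by positivity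
  refine ⟨by nlinarith, ?_, ?_⟩
  · rw [Real.exp_neg, show (t : ℝ) * Real.log 2 = ((t : ℕ) : ℝ) * Real.log 2 by rfl, Real.exp_nat_mul, Real.exp_log two_pos,
      one_div, inv_pow]
  · have h1 : (t : ℝ) * Real.log 2 ≤ t := by nlinarith
    have h2 : Real.logb 2 ((t : ℝ) * Real.log 2) ≤ Real.logb 2 t := Real.logb_le_logb_of_le one_lt_two hL0 h1
    have h3 : 0 ≤ Real.logb 2 ((t : ℝ) * Real.log 2) := by
      rw [Real.le_logb_iff_rpow_le one_lt_two hL0, Real.rpow_zero]; nlinarith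
    nlinarith

/-- ★★★ **THE ROW «UNIFORM MOMENTS → SINGLE MODE» IS `Θ(ωd∕L)`, `L = t·log 2` (both sides in one declaration).**  For `t ≥ 1478`, `ω ≥ 0` and finite
`ι` (`d = |ι|`) with `ωd·(log₂t)² ≤ t∕32768`:
(UPPER, module 146) every two probability laws `P, Q` on `ℝ^ι` carried by `[−1,1]^ι` with `|∫∏x_i^{j_i}dP − ∫∏x_i^{j_i}dQ| ≤ 2^{−t}` for every `j` have
`|∫sin(ωΣ_i|x_i|)dP − ∫sin(ωΣ_i|x_i|)dQ| ≤ 340·ωd∕(t log 2) + e^{−t log 2∕2}`;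
(LOWER, module 138) there are such `P, Q` (mixed moments of total degree `≤ t` equal, all `2^{−t}`-close) with
`∫sin(ωΣ_i|x_i|)dQ − ∫sin(ωΣ_i|x_i|)dP ≥ ωd∕(20πt)`. [folklore] -/
theorem laws_momentCurrency_sinMode_twoSided {t : ℕ} (ht : 1478 ≤ t) {ω : ℝ} (hω : 0 ≤ ω)
    (hreg : ω * Fintype.card ι * Real.logb 2 t ^ 2 ≤ t / 32768) :
    (∀ P Q : Measure (ι → ℝ), IsProbabilityMeasure P → IsProbabilityMeasure Q →
      P (Set.pi Set.univ (fun _ : ι => Set.Icc (-1 : ℝ) 1))ᶜ = 0 → Q (Set.pi Set.univ (fun _ : ι => Set.Icc (-1 : ℝ) 1))ᶜ = 0 →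
      (∀ j : ι → ℕ, |(∫ x, ∏ i, x i ^ j i ∂P) - ∫ x, ∏ i, x i ^ j i ∂Q| ≤ (1 / 2 : ℝ) ^ t) →
      |∫ x, Real.sin (ω * ∑ i, |x i|) ∂P - ∫ x, Real.sin (ω * ∑ i, |x i|) ∂Q| ≤
        340 * (ω * Fintype.card ι) / (t * Real.log 2) + Real.exp (-((t : ℝ) * Real.log 2) / 2)) ∧
    (∃ P Q : Measure (ι → ℝ), IsProbabilityMeasure P ∧ IsProbabilityMeasure Q ∧
      P (Set.pi Set.univ (fun _ : ι => Set.Icc (-1 : ℝ) 1))ᶜ = 0 ∧ Q (Set.pi Set.univ (fun _ : ι => Set.Icc (-1 : ℝ) 1))ᶜ = 0 ∧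
      (∀ j : ι → ℕ, ∑ i, j i ≤ t → ∫ x, ∏ i, x i ^ j i ∂P = ∫ x, ∏ i, x i ^ j i ∂Q) ∧
      (∀ j : ι → ℕ, |(∫ x, ∏ i, x i ^ j i ∂P) - ∫ x, ∏ i, x i ^ j i ∂Q| ≤ (1 / 2 : ℝ) ^ t) ∧
      ω * Fintype.card ι / (20 * π * t) ≤
        (∫ x, Real.sin (ω * ∑ i, |x i|) ∂Q) - ∫ x, Real.sin (ω * ∑ i, |x i|) ∂P) := by
  obtain ⟨hL, hhalf, hlogb⟩ := budget_of_halfPow ht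
  have htr : (1478 : ℝ) ≤ t := by exact_mod_cast ht
  have hhi : Real.log 2 < 0.6931471808 := Real.log_two_lt_d9
  have hlo : 0.6931471803 < Real.log 2 := Real.log_two_gt_d9
  have ha0 : 0 ≤ ω * Fintype.card ι := mul_nonneg hω (Nat.cast_nonneg _)
  -- the regime in the `L`-form and the lower bound's proviso
  have hregL : ω * Fintype.card ι * Real.logb 2 ((t : ℝ) * Real.log 2) ^ 2 ≤ (t : ℝ) * Real.log 2 / 16384 := by
    have h1 := mul_le_mul_of_nonneg_left hlogb ha0
    nlinarith
  have hωd : ω * Fintype.card ι ≤ t / 5 := by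
    have hLb : 10 ≤ Real.logb 2 t := by
      rw [Real.le_logb_iff_rpow_le one_lt_two (by linarith)]
      have e : (2 : ℝ) ^ (10 : ℝ) = 1024 := by norm_num
      rw [e]; linarith
    have h1 : ω * Fintype.card ι * 100 ≤ ω * Fintype.card ι * Real.logb 2 t ^ 2 := mul_le_mul_of_nonneg_left (by nlinarith) ha0
    linarith
  refine ⟨fun P Q iP iQ hP hQ hmom => ?_, exists_laws_closeMixedMoments_sin_l1Norm (le_trans (by norm_num) ht) hω hωd⟩
  have hmom' : ∀ j : ι → ℕ, |(∫ x, ∏ i, x i ^ j i ∂P) - ∫ x, ∏ i, x i ^ j i ∂Q| ≤ Real.exp (-((t : ℝ) * Real.log 2)) :=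
    fun j => (hmom j).trans_eq hhalf
  exact abs_integral_sin_l1Norm_sub_le_logFree hP hQ hL hmom' hω hregL

end Summit.QuantumFields.YangMills.Theorems.BalabanUVNodesN19SingleModeMomentTwoSided

end
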